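import Summits.QuantumFields.BalabanUV.Beta.GAN24.SlotDefectWindowLegs

/-!
# `BalabanUV.Beta.GAN24.SlotDefectWindowNests` — binder row G-an2-4 ∕ (CONV-C), CT-W, route of record «WC-TL»; ι-WIN PART 5 (journal INTENT [LEAF02-G53-ONLINE], X1 INFO I1):
# **THE FIVE `|S| ≥ 3` NESTS OF T-DL (`D_{2,1,L₁}`, `D_{2,1,L₂}`, `D_{2,L₁,L₂}`, `D_{1,L₁,L₂}`, `D_{2,1,L₁,L₂}`) ARE BOUNDED ENTRYWISE BY `|S|`-FOLD WINDOW SUMS OF THE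
# `S`-FOLD MIXED DIVERGENCES; multiplier rows ∕ columns vanish** — completing the operator half of row (Q-D) for all fifteen terms of leaf-06's `tableDress_sub_self_eq_fifteen`

NOT IN PRINT; OUR BOOKKEEPING (G-an2-4 crux team (2), leaf prover `b2b-balaban-gan24-formalise-leaf-02`, gen 53).  [folklore] finite-window bookkeeping: PART 1's one-form core
iterated on REAL multi-slot functions (§1: the double and triple window defects of a real function of two ∕ three bond arguments, and their linearity), then the kernel
entries of the nests read as such functions (§2–§3).  Generic `d + 1`, in-block root, `1 ≤ N`; NO decay hypothesis; 0 `def`, 0 cited facts, 0 `def … : Prop`, 0 sorry.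
HONEST FRAMING (cell contract, verbatim): «discharging `BetaPertH` makes Bałaban's UV stability UNCONDITIONAL — a real constructive-QFT result; it is NOT the continuum
limit and NOT the Clay problem.»  HONEST DEPENDENCY (verbatim): «continuum YM on T⁴ ⇐ BetaPertH ∧ nine spine estimates (0/9 proved); BetaPertH ⇐ (D1) ∧ (D4) ∧ CAP+tail;
G-an2-4 gates asym, D1 and NE2/3/4.»  The leg divergences are NOT slaved today ((Q-L) OPEN); operator lemmas only; discharges NOTHING of (Q-D) ∕ (H) ∕ (Q-R) ∕ (Q-L) ∕
«T2Shape» ∕ «T2Drift» ∕ (hW, hWall); NEVER «G-an2-4 closed» as (CONV-C); NOT D1, NOT `BetaPertH`, NOT continuum, NOT Clay.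
-/

noncomputable section

open Finset
open scoped BigOperators
open Literature.MathematicalPhysics.QuantumFieldTheory
open Literature.MathematicalPhysics.QuantumFieldTheory.Balaban1983to89
open Literature.MathematicalPhysics.QuantumFieldTheory.Balaban1983to89.Beta
open ExpKernelCalculus (MKer Site)
open AffineAveraging (Form0 Form1 box toSite unitVec)
open OneStepResolventKernel (Fib)
open Summit.QuantumFields.BalabanUV.Beta.AxialDressingRooted (cube coProjBmAt coProjBmAtK coProjBmAtK_eval legCo₁BmAt legCo₂BmAt legCo₁BmAt_inl legCo₂BmAt_inl
  legCo₁BmAt_inr legCo₂BmAt_inr)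
open Summit.QuantumFields.BalabanUV.Beta.GAN24.BiStencilZeroMode (Tab)
open Summit.QuantumFields.BalabanUV.Beta.GAN24.SlotDefectWindowBound (abs_coProjBmAt_sub_self_le coProjBmAt_finset_sum_sub two_mul_nonneg)
open Summit.QuantumFields.BalabanUV.Beta.GAN24.SlotDefectWindowLegs (abs_legDefect₁_inl_le abs_legDefect₂_inl_le legDefect₁_inr legDefect₂_inr)

namespace Summit.QuantumFields.BalabanUV.Beta.GAN24.SlotDefectWindowNests

variable {d : ℕ}

/-! ## §1 Real multi-slot functions: the double and triple window defects -/

section Real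

variable {N : ℕ} {r : Fin (d + 1) → ℕ}

/-- [folklore] **LINEARITY OF THE ONE-SLOT REAL DEFECT over finite sums of differences** (`(Πᵀ_bm − 1)(Σ_i (g₁ i − g₂ i)) = Σ_i ((Πᵀ_bm − 1) g₁ i − (Πᵀ_bm − 1) g₂ i)`). -/
theorem defect₁_finset_sum_sub {ι : Type*} (s : Finset ι) (ρ : Fin (d + 1) → ℤ) (N : ℕ) (g₁ g₂ : ι → Form1 (d + 1) ℝ) (α : Fin (d + 1)) (q : Fin (d + 1) → ℤ) :
    coProjBmAt ρ N (fun β p => ∑ i ∈ s, (g₁ i β p - g₂ i β p)) α q - ∑ i ∈ s, (g₁ i α q - g₂ i α q)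
      = ∑ i ∈ s, ((coProjBmAt ρ N (g₁ i) α q - g₁ i α q) - (coProjBmAt ρ N (g₂ i) α q - g₂ i α q)) := by
  rw [coProjBmAt_finset_sum_sub, ← Finset.sum_sub_distrib]
  refine Finset.sum_congr rfl fun i _ => ?_
  ring

/-- NOT IN PRINT; OUR BOOKKEEPING.  **THE DOUBLE WINDOW DEFECT OF A REAL TWO-SLOT FUNCTION** `H : (κ₁,u₁), (κ₂,u₂) ↦ ℝ` (in-block root, `1 ≤ N`):
`|(Π−1)₁ [(Π−1)₂ H] (κ u; κ′ u′)| ≤ (2(d+1)N)² · Σ_v Σ_{v′} |Σ_{β′} (Σ_β (H β (u+v) β′ (u′+v′) − H β (u+v−e_β) β′ (u′+v′)) − Σ_β (H β (u+v) β′ (u′+v′−e_{β′}) − H β (u+v−e_β) β′ (u′+v′−e_{β′})))|`. -/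
theorem abs_realDefect₂_le (hN : 1 ≤ N) (hr : r ∈ box (d + 1) N) (H : Fin (d + 1) → (Fin (d + 1) → ℤ) → Form1 (d + 1) ℝ) (κ : Fin (d + 1))
    (u : Fin (d + 1) → ℤ) (κ' : Fin (d + 1)) (u' : Fin (d + 1) → ℤ) :
    |coProjBmAt (toSite r) N (fun κ₁ u₁ => coProjBmAt (toSite r) N (H κ₁ u₁) κ' u' - H κ₁ u₁ κ' u') κ u
        - (coProjBmAt (toSite r) N (H κ u) κ' u' - H κ u κ' u')|
      ≤ (2 * ((d : ℝ) + 1) * N) ^ 2 * ∑ v ∈ cube (d + 1) N, ∑ v' ∈ cube (d + 1) N,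
          |∑ β' : Fin (d + 1), ((∑ β : Fin (d + 1), (H β (u + v) β' (u' + v') - H β (u + v - unitVec β) β' (u' + v')))
            - (∑ β : Fin (d + 1), (H β (u + v) β' (u' + v' - unitVec β') - H β (u + v - unitVec β) β' (u' + v' - unitVec β'))))| := by
  have h1 := abs_coProjBmAt_sub_self_le hN hr (fun κ₁ u₁ => coProjBmAt (toSite r) N (H κ₁ u₁) κ' u' - H κ₁ u₁ κ' u') κ u
  have h3 : ∀ v ∈ cube (d + 1) N,
      |∑ β : Fin (d + 1), ((coProjBmAt (toSite r) N (H β (u + v)) κ' u' - H β (u + v) κ' u')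
          - (coProjBmAt (toSite r) N (H β (u + v - unitVec β)) κ' u' - H β (u + v - unitVec β) κ' u'))|
        ≤ 2 * ((d : ℝ) + 1) * N * ∑ v' ∈ cube (d + 1) N,
          |∑ β' : Fin (d + 1), ((∑ β : Fin (d + 1), (H β (u + v) β' (u' + v') - H β (u + v - unitVec β) β' (u' + v')))
            - (∑ β : Fin (d + 1), (H β (u + v) β' (u' + v' - unitVec β') - H β (u + v - unitVec β) β' (u' + v' - unitVec β'))))| := by
    intro v _
    rw [← defect₁_finset_sum_sub]
    exact abs_coProjBmAt_sub_self_le hN hr _ κ' u'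
  refine h1.trans ?_
  calc 2 * ((d : ℝ) + 1) * N * ∑ v ∈ cube (d + 1) N,
        |∑ β : Fin (d + 1), ((coProjBmAt (toSite r) N (H β (u + v)) κ' u' - H β (u + v) κ' u')
          - (coProjBmAt (toSite r) N (H β (u + v - unitVec β)) κ' u' - H β (u + v - unitVec β) κ' u'))|
      ≤ 2 * ((d : ℝ) + 1) * N * ∑ v ∈ cube (d + 1) N, (2 * ((d : ℝ) + 1) * N * ∑ v' ∈ cube (d + 1) N,
          |∑ β' : Fin (d + 1), ((∑ β : Fin (d + 1), (H β (u + v) β' (u' + v') - H β (u + v - unitVec β) β' (u' + v')))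
            - (∑ β : Fin (d + 1), (H β (u + v) β' (u' + v' - unitVec β') - H β (u + v - unitVec β) β' (u' + v' - unitVec β'))))|) :=
        mul_le_mul_of_nonneg_left (Finset.sum_le_sum h3) (two_mul_nonneg d N)
    _ = _ := by rw [← Finset.mul_sum]; ring

/-- [folklore] **LINEARITY OF THE DOUBLE REAL DEFECT** over finite sums of differences. -/
theorem defect₂_finset_sum_sub {ι : Type*} (s : Finset ι) (ρ : Fin (d + 1) → ℤ) (N : ℕ) (H₁ H₂ : ι → Fin (d + 1) → (Fin (d + 1) → ℤ) → Form1 (d + 1) ℝ)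
    (κ : Fin (d + 1)) (u : Fin (d + 1) → ℤ) (κ' : Fin (d + 1)) (u' : Fin (d + 1) → ℤ) :
    (coProjBmAt ρ N (fun κ₁ u₁ => coProjBmAt ρ N (fun κ₂ u₂ => ∑ i ∈ s, (H₁ i κ₁ u₁ κ₂ u₂ - H₂ i κ₁ u₁ κ₂ u₂)) κ' u'
          - ∑ i ∈ s, (H₁ i κ₁ u₁ κ' u' - H₂ i κ₁ u₁ κ' u')) κ u
        - (coProjBmAt ρ N (fun κ₂ u₂ => ∑ i ∈ s, (H₁ i κ u κ₂ u₂ - H₂ i κ u κ₂ u₂)) κ' u' - ∑ i ∈ s, (H₁ i κ u κ' u' - H₂ i κ u κ' u')))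
      = ∑ i ∈ s, ((coProjBmAt ρ N (fun κ₁ u₁ => coProjBmAt ρ N (H₁ i κ₁ u₁) κ' u' - H₁ i κ₁ u₁ κ' u') κ u
            - (coProjBmAt ρ N (H₁ i κ u) κ' u' - H₁ i κ u κ' u'))
          - (coProjBmAt ρ N (fun κ₁ u₁ => coProjBmAt ρ N (H₂ i κ₁ u₁) κ' u' - H₂ i κ₁ u₁ κ' u') κ u
            - (coProjBmAt ρ N (H₂ i κ u) κ' u' - H₂ i κ u κ' u'))) := by
  have inner : ∀ (κ₁ : Fin (d + 1)) (u₁ : Fin (d + 1) → ℤ),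
      coProjBmAt ρ N (fun κ₂ u₂ => ∑ i ∈ s, (H₁ i κ₁ u₁ κ₂ u₂ - H₂ i κ₁ u₁ κ₂ u₂)) κ' u' - ∑ i ∈ s, (H₁ i κ₁ u₁ κ' u' - H₂ i κ₁ u₁ κ' u')
        = ∑ i ∈ s, ((coProjBmAt ρ N (H₁ i κ₁ u₁) κ' u' - H₁ i κ₁ u₁ κ' u') - (coProjBmAt ρ N (H₂ i κ₁ u₁) κ' u' - H₂ i κ₁ u₁ κ' u')) :=
    fun κ₁ u₁ => defect₁_finset_sum_sub s ρ N (fun i => H₁ i κ₁ u₁) (fun i => H₂ i κ₁ u₁) κ' u'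
  have e : (fun κ₁ u₁ => coProjBmAt ρ N (fun κ₂ u₂ => ∑ i ∈ s, (H₁ i κ₁ u₁ κ₂ u₂ - H₂ i κ₁ u₁ κ₂ u₂)) κ' u'
        - ∑ i ∈ s, (H₁ i κ₁ u₁ κ' u' - H₂ i κ₁ u₁ κ' u'))
      = fun κ₁ u₁ => ∑ i ∈ s, ((coProjBmAt ρ N (H₁ i κ₁ u₁) κ' u' - H₁ i κ₁ u₁ κ' u') - (coProjBmAt ρ N (H₂ i κ₁ u₁) κ' u' - H₂ i κ₁ u₁ κ' u')) := by
    funext κ₁ u₁; exact inner κ₁ u₁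
  rw [e, inner κ u, defect₁_finset_sum_sub]

/-- NOT IN PRINT; OUR BOOKKEEPING.  **THE TRIPLE WINDOW DEFECT OF A REAL THREE-SLOT FUNCTION** `F : (κ₀,u₀), (κ₁,u₁), (κ₂,u₂) ↦ ℝ` (in-block root, `1 ≤ N`): the nest
`(Π−1)₀ [(Π−1)₁ (Π−1)₂ F]` at `(κ₀ u₀; κ u; κ′ u′)` is bounded by `(2(d+1)N)³` times the triple window sum of the triple mixed difference. -/
theorem abs_realDefect₃_le (hN : 1 ≤ N) (hr : r ∈ box (d + 1) N) (F : Fin (d + 1) → (Fin (d + 1) → ℤ) → Fin (d + 1) → (Fin (d + 1) → ℤ) → Form1 (d + 1) ℝ)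
    (κ₀ : Fin (d + 1)) (u₀ : Fin (d + 1) → ℤ) (κ : Fin (d + 1)) (u : Fin (d + 1) → ℤ) (κ' : Fin (d + 1)) (u' : Fin (d + 1) → ℤ) :
    |coProjBmAt (toSite r) N (fun κ₃ u₃ =>
          coProjBmAt (toSite r) N (fun κ₁ u₁ => coProjBmAt (toSite r) N (F κ₃ u₃ κ₁ u₁) κ' u' - F κ₃ u₃ κ₁ u₁ κ' u') κ u
            - (coProjBmAt (toSite r) N (F κ₃ u₃ κ u) κ' u' - F κ₃ u₃ κ u κ' u')) κ₀ u₀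
        - (coProjBmAt (toSite r) N (fun κ₁ u₁ => coProjBmAt (toSite r) N (F κ₀ u₀ κ₁ u₁) κ' u' - F κ₀ u₀ κ₁ u₁ κ' u') κ u
            - (coProjBmAt (toSite r) N (F κ₀ u₀ κ u) κ' u' - F κ₀ u₀ κ u κ' u'))|
      ≤ (2 * ((d : ℝ) + 1) * N) ^ 3 * ∑ v₀ ∈ cube (d + 1) N, ∑ v ∈ cube (d + 1) N, ∑ v' ∈ cube (d + 1) N,
          |∑ β' : Fin (d + 1),
            ((∑ β : Fin (d + 1), ((∑ γ : Fin (d + 1), (F γ (u₀ + v₀) β (u + v) β' (u' + v') - F γ (u₀ + v₀ - unitVec γ) β (u + v) β' (u' + v')))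
                - (∑ γ : Fin (d + 1), (F γ (u₀ + v₀) β (u + v - unitVec β) β' (u' + v') - F γ (u₀ + v₀ - unitVec γ) β (u + v - unitVec β) β' (u' + v')))))
            - (∑ β : Fin (d + 1), ((∑ γ : Fin (d + 1), (F γ (u₀ + v₀) β (u + v) β' (u' + v' - unitVec β') - F γ (u₀ + v₀ - unitVec γ) β (u + v) β' (u' + v' - unitVec β')))
                - (∑ γ : Fin (d + 1), (F γ (u₀ + v₀) β (u + v - unitVec β) β' (u' + v' - unitVec β')
                    - F γ (u₀ + v₀ - unitVec γ) β (u + v - unitVec β) β' (u' + v' - unitVec β'))))))| := by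
  -- outer window in the variable `(κ₀, u₀)`
  have h1 := abs_coProjBmAt_sub_self_le hN hr (fun κ₃ u₃ =>
      coProjBmAt (toSite r) N (fun κ₁ u₁ => coProjBmAt (toSite r) N (F κ₃ u₃ κ₁ u₁) κ' u' - F κ₃ u₃ κ₁ u₁ κ' u') κ u
        - (coProjBmAt (toSite r) N (F κ₃ u₃ κ u) κ' u' - F κ₃ u₃ κ u κ' u')) κ₀ u₀
  -- the difference in `u₀` passes inside the double defect, which is then bounded by §1's double lemma
  have h3 : ∀ v₀ ∈ cube (d + 1) N,
      |∑ γ : Fin (d + 1), ((coProjBmAt (toSite r) N (fun κ₁ u₁ => coProjBmAt (toSite r) N (F γ (u₀ + v₀) κ₁ u₁) κ' u' - F γ (u₀ + v₀) κ₁ u₁ κ' u') κ u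
            - (coProjBmAt (toSite r) N (F γ (u₀ + v₀) κ u) κ' u' - F γ (u₀ + v₀) κ u κ' u'))
          - (coProjBmAt (toSite r) N (fun κ₁ u₁ => coProjBmAt (toSite r) N (F γ (u₀ + v₀ - unitVec γ) κ₁ u₁) κ' u' - F γ (u₀ + v₀ - unitVec γ) κ₁ u₁ κ' u') κ u
            - (coProjBmAt (toSite r) N (F γ (u₀ + v₀ - unitVec γ) κ u) κ' u' - F γ (u₀ + v₀ - unitVec γ) κ u κ' u')))|
        ≤ (2 * ((d : ℝ) + 1) * N) ^ 2 * ∑ v ∈ cube (d + 1) N, ∑ v' ∈ cube (d + 1) N,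
          |∑ β' : Fin (d + 1),
            ((∑ β : Fin (d + 1), ((∑ γ : Fin (d + 1), (F γ (u₀ + v₀) β (u + v) β' (u' + v') - F γ (u₀ + v₀ - unitVec γ) β (u + v) β' (u' + v')))
                - (∑ γ : Fin (d + 1), (F γ (u₀ + v₀) β (u + v - unitVec β) β' (u' + v') - F γ (u₀ + v₀ - unitVec γ) β (u + v - unitVec β) β' (u' + v')))))
            - (∑ β : Fin (d + 1), ((∑ γ : Fin (d + 1), (F γ (u₀ + v₀) β (u + v) β' (u' + v' - unitVec β') - F γ (u₀ + v₀ - unitVec γ) β (u + v) β' (u' + v' - unitVec β')))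
                - (∑ γ : Fin (d + 1), (F γ (u₀ + v₀) β (u + v - unitVec β) β' (u' + v' - unitVec β')
                    - F γ (u₀ + v₀ - unitVec γ) β (u + v - unitVec β) β' (u' + v' - unitVec β'))))))| := by
    intro v₀ _
    rw [← defect₂_finset_sum_sub]
    exact abs_realDefect₂_le hN hr (fun κ₁ u₁ κ₂ u₂ => ∑ γ : Fin (d + 1), (F γ (u₀ + v₀) κ₁ u₁ κ₂ u₂ - F γ (u₀ + v₀ - unitVec γ) κ₁ u₁ κ₂ u₂)) κ u κ' u'
  refine h1.trans ?_
  calc 2 * ((d : ℝ) + 1) * N * ∑ v₀ ∈ cube (d + 1) N,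
        |∑ γ : Fin (d + 1), ((coProjBmAt (toSite r) N (fun κ₁ u₁ => coProjBmAt (toSite r) N (F γ (u₀ + v₀) κ₁ u₁) κ' u' - F γ (u₀ + v₀) κ₁ u₁ κ' u') κ u
            - (coProjBmAt (toSite r) N (F γ (u₀ + v₀) κ u) κ' u' - F γ (u₀ + v₀) κ u κ' u'))
          - (coProjBmAt (toSite r) N (fun κ₁ u₁ => coProjBmAt (toSite r) N (F γ (u₀ + v₀ - unitVec γ) κ₁ u₁) κ' u' - F γ (u₀ + v₀ - unitVec γ) κ₁ u₁ κ' u') κ u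
            - (coProjBmAt (toSite r) N (F γ (u₀ + v₀ - unitVec γ) κ u) κ' u' - F γ (u₀ + v₀ - unitVec γ) κ u κ' u')))|
      ≤ 2 * ((d : ℝ) + 1) * N * ∑ v₀ ∈ cube (d + 1) N, ((2 * ((d : ℝ) + 1) * N) ^ 2 * ∑ v ∈ cube (d + 1) N, ∑ v' ∈ cube (d + 1) N,
          |∑ β' : Fin (d + 1),
            ((∑ β : Fin (d + 1), ((∑ γ : Fin (d + 1), (F γ (u₀ + v₀) β (u + v) β' (u' + v') - F γ (u₀ + v₀ - unitVec γ) β (u + v) β' (u' + v')))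
                - (∑ γ : Fin (d + 1), (F γ (u₀ + v₀) β (u + v - unitVec β) β' (u' + v') - F γ (u₀ + v₀ - unitVec γ) β (u + v - unitVec β) β' (u' + v')))))
            - (∑ β : Fin (d + 1), ((∑ γ : Fin (d + 1), (F γ (u₀ + v₀) β (u + v) β' (u' + v' - unitVec β') - F γ (u₀ + v₀ - unitVec γ) β (u + v) β' (u' + v' - unitVec β')))
                - (∑ γ : Fin (d + 1), (F γ (u₀ + v₀) β (u + v - unitVec β) β' (u' + v' - unitVec β')
                    - F γ (u₀ + v₀ - unitVec γ) β (u + v - unitVec β) β' (u' + v' - unitVec β'))))))|) :=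
        mul_le_mul_of_nonneg_left (Finset.sum_le_sum h3) (two_mul_nonneg d N)
    _ = _ := by rw [← Finset.mul_sum]; ring

/-- [folklore] **LINEARITY OF THE TRIPLE REAL DEFECT** over finite sums of differences. -/
theorem defect₃_finset_sum_sub {ι : Type*} (s : Finset ι) (ρ : Fin (d + 1) → ℤ) (N : ℕ)
    (F₁ F₂ : ι → Fin (d + 1) → (Fin (d + 1) → ℤ) → Fin (d + 1) → (Fin (d + 1) → ℤ) → Form1 (d + 1) ℝ)
    (κ₀ : Fin (d + 1)) (u₀ : Fin (d + 1) → ℤ) (κ : Fin (d + 1)) (u : Fin (d + 1) → ℤ) (κ' : Fin (d + 1)) (u' : Fin (d + 1) → ℤ) :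
    (coProjBmAt ρ N (fun κ₃ u₃ =>
          coProjBmAt ρ N (fun κ₁ u₁ => coProjBmAt ρ N (fun κ₂ u₂ => ∑ i ∈ s, (F₁ i κ₃ u₃ κ₁ u₁ κ₂ u₂ - F₂ i κ₃ u₃ κ₁ u₁ κ₂ u₂)) κ' u'
              - ∑ i ∈ s, (F₁ i κ₃ u₃ κ₁ u₁ κ' u' - F₂ i κ₃ u₃ κ₁ u₁ κ' u')) κ u
            - (coProjBmAt ρ N (fun κ₂ u₂ => ∑ i ∈ s, (F₁ i κ₃ u₃ κ u κ₂ u₂ - F₂ i κ₃ u₃ κ u κ₂ u₂)) κ' u'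
              - ∑ i ∈ s, (F₁ i κ₃ u₃ κ u κ' u' - F₂ i κ₃ u₃ κ u κ' u'))) κ₀ u₀
        - (coProjBmAt ρ N (fun κ₁ u₁ => coProjBmAt ρ N (fun κ₂ u₂ => ∑ i ∈ s, (F₁ i κ₀ u₀ κ₁ u₁ κ₂ u₂ - F₂ i κ₀ u₀ κ₁ u₁ κ₂ u₂)) κ' u'
              - ∑ i ∈ s, (F₁ i κ₀ u₀ κ₁ u₁ κ' u' - F₂ i κ₀ u₀ κ₁ u₁ κ' u')) κ u
            - (coProjBmAt ρ N (fun κ₂ u₂ => ∑ i ∈ s, (F₁ i κ₀ u₀ κ u κ₂ u₂ - F₂ i κ₀ u₀ κ u κ₂ u₂)) κ' u'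
              - ∑ i ∈ s, (F₁ i κ₀ u₀ κ u κ' u' - F₂ i κ₀ u₀ κ u κ' u'))))
      = ∑ i ∈ s,
          ((coProjBmAt ρ N (fun κ₃ u₃ =>
              coProjBmAt ρ N (fun κ₁ u₁ => coProjBmAt ρ N (F₁ i κ₃ u₃ κ₁ u₁) κ' u' - F₁ i κ₃ u₃ κ₁ u₁ κ' u') κ u
                - (coProjBmAt ρ N (F₁ i κ₃ u₃ κ u) κ' u' - F₁ i κ₃ u₃ κ u κ' u')) κ₀ u₀
            - (coProjBmAt ρ N (fun κ₁ u₁ => coProjBmAt ρ N (F₁ i κ₀ u₀ κ₁ u₁) κ' u' - F₁ i κ₀ u₀ κ₁ u₁ κ' u') κ u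
                - (coProjBmAt ρ N (F₁ i κ₀ u₀ κ u) κ' u' - F₁ i κ₀ u₀ κ u κ' u')))
          - (coProjBmAt ρ N (fun κ₃ u₃ =>
              coProjBmAt ρ N (fun κ₁ u₁ => coProjBmAt ρ N (F₂ i κ₃ u₃ κ₁ u₁) κ' u' - F₂ i κ₃ u₃ κ₁ u₁ κ' u') κ u
                - (coProjBmAt ρ N (F₂ i κ₃ u₃ κ u) κ' u' - F₂ i κ₃ u₃ κ u κ' u')) κ₀ u₀
            - (coProjBmAt ρ N (fun κ₁ u₁ => coProjBmAt ρ N (F₂ i κ₀ u₀ κ₁ u₁) κ' u' - F₂ i κ₀ u₀ κ₁ u₁ κ' u') κ u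
                - (coProjBmAt ρ N (F₂ i κ₀ u₀ κ u) κ' u' - F₂ i κ₀ u₀ κ u κ' u')))) := by
  have inner : ∀ (κ₃ : Fin (d + 1)) (u₃ : Fin (d + 1) → ℤ),
      coProjBmAt ρ N (fun κ₁ u₁ => coProjBmAt ρ N (fun κ₂ u₂ => ∑ i ∈ s, (F₁ i κ₃ u₃ κ₁ u₁ κ₂ u₂ - F₂ i κ₃ u₃ κ₁ u₁ κ₂ u₂)) κ' u'
            - ∑ i ∈ s, (F₁ i κ₃ u₃ κ₁ u₁ κ' u' - F₂ i κ₃ u₃ κ₁ u₁ κ' u')) κ u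
          - (coProjBmAt ρ N (fun κ₂ u₂ => ∑ i ∈ s, (F₁ i κ₃ u₃ κ u κ₂ u₂ - F₂ i κ₃ u₃ κ u κ₂ u₂)) κ' u'
            - ∑ i ∈ s, (F₁ i κ₃ u₃ κ u κ' u' - F₂ i κ₃ u₃ κ u κ' u'))
        = ∑ i ∈ s, ((coProjBmAt ρ N (fun κ₁ u₁ => coProjBmAt ρ N (F₁ i κ₃ u₃ κ₁ u₁) κ' u' - F₁ i κ₃ u₃ κ₁ u₁ κ' u') κ u
              - (coProjBmAt ρ N (F₁ i κ₃ u₃ κ u) κ' u' - F₁ i κ₃ u₃ κ u κ' u'))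
            - (coProjBmAt ρ N (fun κ₁ u₁ => coProjBmAt ρ N (F₂ i κ₃ u₃ κ₁ u₁) κ' u' - F₂ i κ₃ u₃ κ₁ u₁ κ' u') κ u
              - (coProjBmAt ρ N (F₂ i κ₃ u₃ κ u) κ' u' - F₂ i κ₃ u₃ κ u κ' u'))) :=
    fun κ₃ u₃ => defect₂_finset_sum_sub s ρ N (fun i => F₁ i κ₃ u₃) (fun i => F₂ i κ₃ u₃) κ u κ' u'
  have e : (fun κ₃ u₃ =>
      coProjBmAt ρ N (fun κ₁ u₁ => coProjBmAt ρ N (fun κ₂ u₂ => ∑ i ∈ s, (F₁ i κ₃ u₃ κ₁ u₁ κ₂ u₂ - F₂ i κ₃ u₃ κ₁ u₁ κ₂ u₂)) κ' u'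
            - ∑ i ∈ s, (F₁ i κ₃ u₃ κ₁ u₁ κ' u' - F₂ i κ₃ u₃ κ₁ u₁ κ' u')) κ u
          - (coProjBmAt ρ N (fun κ₂ u₂ => ∑ i ∈ s, (F₁ i κ₃ u₃ κ u κ₂ u₂ - F₂ i κ₃ u₃ κ u κ₂ u₂)) κ' u'
            - ∑ i ∈ s, (F₁ i κ₃ u₃ κ u κ' u' - F₂ i κ₃ u₃ κ u κ' u')))
      = fun κ₃ u₃ => ∑ i ∈ s, ((coProjBmAt ρ N (fun κ₁ u₁ => coProjBmAt ρ N (F₁ i κ₃ u₃ κ₁ u₁) κ' u' - F₁ i κ₃ u₃ κ₁ u₁ κ' u') κ u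
              - (coProjBmAt ρ N (F₁ i κ₃ u₃ κ u) κ' u' - F₁ i κ₃ u₃ κ u κ' u'))
            - (coProjBmAt ρ N (fun κ₁ u₁ => coProjBmAt ρ N (F₂ i κ₃ u₃ κ₁ u₁) κ' u' - F₂ i κ₃ u₃ κ₁ u₁ κ' u') κ u
              - (coProjBmAt ρ N (F₂ i κ₃ u₃ κ u) κ' u' - F₂ i κ₃ u₃ κ u κ' u'))) := by
    funext κ₃ u₃; exact inner κ₃ u₃
  rw [e, inner κ₀ u₀, defect₁_finset_sum_sub]

end Real

/-! ## §2 Reading the kernel entries of the nests as real multi-slot functions -/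

section Read

variable (ρ : Fin (d + 1) → ℤ) (N : ℕ)

/-- [folklore] The entry of `D_{2,1} Y = P₁ (P₂ Y − Y) − (P₂ Y − Y)` at `(x, z, a, b)` is the real double defect of the two-slot function `(κ₁u₁, κ₂u₂) ↦ Y κ₁ u₁ κ₂ u₂ x z a b`. -/
theorem defect_fst_snd_apply (Y : Tab d) (κ : Fin (d + 1)) (u : Fin (d + 1) → ℤ) (κ' : Fin (d + 1)) (u' x z : Fin (d + 1) → ℤ) (a b : Fib d) :
    ((fun κ u κ' u' => coProjBmAtK ρ N (fun κ₁ u₁ => ((fun κ u => coProjBmAtK ρ N (Y κ u)) - Y) κ₁ u₁ κ' u') κ u)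
        - ((fun κ u => coProjBmAtK ρ N (Y κ u)) - Y)) κ u κ' u' x z a b
      = coProjBmAt ρ N (fun κ₁ u₁ => coProjBmAt ρ N (fun κ₂ u₂ => Y κ₁ u₁ κ₂ u₂ x z a b) κ' u' - Y κ₁ u₁ κ' u' x z a b) κ u
        - (coProjBmAt ρ N (fun κ₂ u₂ => Y κ u κ₂ u₂ x z a b) κ' u' - Y κ u κ' u' x z a b) := by
  simp only [Pi.sub_apply, coProjBmAtK_eval]

end Read

/-! ## §3 The five `|S| ≥ 3` nests -/

section Nests

variable {N : ℕ} {r : Fin (d + 1) → ℕ}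

/-- NOT IN PRINT; OUR BOOKKEEPING.  **`D_{2,1,L₁} = L₁ (D_{2,1} Y) − D_{2,1} Y` ON FIELD ROWS** (in-block root, `1 ≤ N`, ANY table): bounded by `(2(d+1)N)³` times the triple
window sum of the mixed divergence `∂₁^{slot}∂₂^{slot}∂₁^{leg} Y` (first slot at `u + v₁`, second slot at `u′ + v₂`, first leg at `x + v`). -/
theorem abs_defect_fst_snd_leg₁_le (hN : 1 ≤ N) (hr : r ∈ box (d + 1) N) (Y : Tab d) (κ : Fin (d + 1)) (u : Fin (d + 1) → ℤ) (κ' : Fin (d + 1))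
    (u' x z : Fin (d + 1) → ℤ) (α : Fin (d + 1)) (b : Fib d) :
    |((fun κ u κ' u' => legCo₁BmAt (toSite r) N
          (((fun κ u κ' u' => coProjBmAtK (toSite r) N (fun κ₁ u₁ => ((fun κ u => coProjBmAtK (toSite r) N (Y κ u)) - Y) κ₁ u₁ κ' u') κ u)
            - ((fun κ u => coProjBmAtK (toSite r) N (Y κ u)) - Y)) κ u κ' u'))
        - ((fun κ u κ' u' => coProjBmAtK (toSite r) N (fun κ₁ u₁ => ((fun κ u => coProjBmAtK (toSite r) N (Y κ u)) - Y) κ₁ u₁ κ' u') κ u)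
            - ((fun κ u => coProjBmAtK (toSite r) N (Y κ u)) - Y))) κ u κ' u' x z (Sum.inl α) b|
      ≤ (2 * ((d : ℝ) + 1) * N) ^ 3 * ∑ v ∈ cube (d + 1) N, ∑ v₁ ∈ cube (d + 1) N, ∑ v₂ ∈ cube (d + 1) N,
          |∑ β' : Fin (d + 1),
            ((∑ β : Fin (d + 1), ((∑ γ : Fin (d + 1), (Y β (u + v₁) β' (u' + v₂) (x + v) z (Sum.inl γ) b - Y β (u + v₁) β' (u' + v₂) (x + v - unitVec γ) z (Sum.inl γ) b))
                - (∑ γ : Fin (d + 1), (Y β (u + v₁ - unitVec β) β' (u' + v₂) (x + v) z (Sum.inl γ) b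
                    - Y β (u + v₁ - unitVec β) β' (u' + v₂) (x + v - unitVec γ) z (Sum.inl γ) b))))
            - (∑ β : Fin (d + 1), ((∑ γ : Fin (d + 1), (Y β (u + v₁) β' (u' + v₂ - unitVec β') (x + v) z (Sum.inl γ) b
                    - Y β (u + v₁) β' (u' + v₂ - unitVec β') (x + v - unitVec γ) z (Sum.inl γ) b))
                - (∑ γ : Fin (d + 1), (Y β (u + v₁ - unitVec β) β' (u' + v₂ - unitVec β') (x + v) z (Sum.inl γ) b
                    - Y β (u + v₁ - unitVec β) β' (u' + v₂ - unitVec β') (x + v - unitVec γ) z (Sum.inl γ) b)))))| := by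
  set U : Tab d := (fun κ u κ' u' => coProjBmAtK (toSite r) N (fun κ₁ u₁ => ((fun κ u => coProjBmAtK (toSite r) N (Y κ u)) - Y) κ₁ u₁ κ' u') κ u)
      - ((fun κ u => coProjBmAtK (toSite r) N (Y κ u)) - Y) with hU
  have h1 := abs_legDefect₁_inl_le hN hr U κ u κ' u' x z α b
  -- the leg difference passes inside the double source defect; then §1's double lemma
  have h3 : ∀ v ∈ cube (d + 1) N, |∑ γ : Fin (d + 1), (U κ u κ' u' (x + v) z (Sum.inl γ) b - U κ u κ' u' (x + v - unitVec γ) z (Sum.inl γ) b)|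
      ≤ (2 * ((d : ℝ) + 1) * N) ^ 2 * ∑ v₁ ∈ cube (d + 1) N, ∑ v₂ ∈ cube (d + 1) N,
          |∑ β' : Fin (d + 1),
            ((∑ β : Fin (d + 1), ((∑ γ : Fin (d + 1), (Y β (u + v₁) β' (u' + v₂) (x + v) z (Sum.inl γ) b - Y β (u + v₁) β' (u' + v₂) (x + v - unitVec γ) z (Sum.inl γ) b))
                - (∑ γ : Fin (d + 1), (Y β (u + v₁ - unitVec β) β' (u' + v₂) (x + v) z (Sum.inl γ) b
                    - Y β (u + v₁ - unitVec β) β' (u' + v₂) (x + v - unitVec γ) z (Sum.inl γ) b))))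
            - (∑ β : Fin (d + 1), ((∑ γ : Fin (d + 1), (Y β (u + v₁) β' (u' + v₂ - unitVec β') (x + v) z (Sum.inl γ) b
                    - Y β (u + v₁) β' (u' + v₂ - unitVec β') (x + v - unitVec γ) z (Sum.inl γ) b))
                - (∑ γ : Fin (d + 1), (Y β (u + v₁ - unitVec β) β' (u' + v₂ - unitVec β') (x + v) z (Sum.inl γ) b
                    - Y β (u + v₁ - unitVec β) β' (u' + v₂ - unitVec β') (x + v - unitVec γ) z (Sum.inl γ) b)))))| := by
    intro v _
    have e : ∑ γ : Fin (d + 1), (U κ u κ' u' (x + v) z (Sum.inl γ) b - U κ u κ' u' (x + v - unitVec γ) z (Sum.inl γ) b)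
        = coProjBmAt (toSite r) N (fun κ₁ u₁ => coProjBmAt (toSite r) N (fun κ₂ u₂ =>
              ∑ γ : Fin (d + 1), (Y κ₁ u₁ κ₂ u₂ (x + v) z (Sum.inl γ) b - Y κ₁ u₁ κ₂ u₂ (x + v - unitVec γ) z (Sum.inl γ) b)) κ' u'
            - ∑ γ : Fin (d + 1), (Y κ₁ u₁ κ' u' (x + v) z (Sum.inl γ) b - Y κ₁ u₁ κ' u' (x + v - unitVec γ) z (Sum.inl γ) b)) κ u
          - (coProjBmAt (toSite r) N (fun κ₂ u₂ =>
              ∑ γ : Fin (d + 1), (Y κ u κ₂ u₂ (x + v) z (Sum.inl γ) b - Y κ u κ₂ u₂ (x + v - unitVec γ) z (Sum.inl γ) b)) κ' u'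
            - ∑ γ : Fin (d + 1), (Y κ u κ' u' (x + v) z (Sum.inl γ) b - Y κ u κ' u' (x + v - unitVec γ) z (Sum.inl γ) b)) := by
      rw [defect₂_finset_sum_sub]
      refine Finset.sum_congr rfl fun γ _ => ?_
      rw [hU, defect_fst_snd_apply, defect_fst_snd_apply]
    rw [e]
    exact abs_realDefect₂_le hN hr (fun κ₁ u₁ κ₂ u₂ =>
      ∑ γ : Fin (d + 1), (Y κ₁ u₁ κ₂ u₂ (x + v) z (Sum.inl γ) b - Y κ₁ u₁ κ₂ u₂ (x + v - unitVec γ) z (Sum.inl γ) b)) κ u κ' u'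
  refine h1.trans ((mul_le_mul_of_nonneg_left (Finset.sum_le_sum h3) (two_mul_nonneg d N)).trans (le_of_eq ?_))
  rw [← Finset.mul_sum]
  ring

/-- [folklore] `D_{2,1,L₁}` vanishes on multiplier rows. -/
theorem defect_fst_snd_leg₁_inr (ρ : Fin (d + 1) → ℤ) (N : ℕ) (Y : Tab d) (κ : Fin (d + 1)) (u : Fin (d + 1) → ℤ) (κ' : Fin (d + 1))
    (u' x z : Fin (d + 1) → ℤ) (m : Fin (d + 1)) (b : Fib d) :
    ((fun κ u κ' u' => legCo₁BmAt ρ N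
          (((fun κ u κ' u' => coProjBmAtK ρ N (fun κ₁ u₁ => ((fun κ u => coProjBmAtK ρ N (Y κ u)) - Y) κ₁ u₁ κ' u') κ u)
            - ((fun κ u => coProjBmAtK ρ N (Y κ u)) - Y)) κ u κ' u'))
        - ((fun κ u κ' u' => coProjBmAtK ρ N (fun κ₁ u₁ => ((fun κ u => coProjBmAtK ρ N (Y κ u)) - Y) κ₁ u₁ κ' u') κ u)
            - ((fun κ u => coProjBmAtK ρ N (Y κ u)) - Y))) κ u κ' u' x z (Sum.inr m) b = 0 :=
  legDefect₁_inr ρ N _ κ u κ' u' x z m b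

/-- NOT IN PRINT; OUR BOOKKEEPING.  **`D_{2,1,L₂} = L₂ (D_{2,1} Y) − D_{2,1} Y` ON FIELD COLUMNS**: bounded by `(2(d+1)N)³` times the triple window sum of
`∂₁^{slot}∂₂^{slot}∂₂^{leg} Y` (first slot at `u + v₁`, second slot at `u′ + v₂`, second leg at `z + v`). -/
theorem abs_defect_fst_snd_leg₂_le (hN : 1 ≤ N) (hr : r ∈ box (d + 1) N) (Y : Tab d) (κ : Fin (d + 1)) (u : Fin (d + 1) → ℤ) (κ' : Fin (d + 1))
    (u' x z : Fin (d + 1) → ℤ) (a : Fib d) (β₀ : Fin (d + 1)) :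
    |((fun κ u κ' u' => legCo₂BmAt (toSite r) N
          (((fun κ u κ' u' => coProjBmAtK (toSite r) N (fun κ₁ u₁ => ((fun κ u => coProjBmAtK (toSite r) N (Y κ u)) - Y) κ₁ u₁ κ' u') κ u)
            - ((fun κ u => coProjBmAtK (toSite r) N (Y κ u)) - Y)) κ u κ' u'))
        - ((fun κ u κ' u' => coProjBmAtK (toSite r) N (fun κ₁ u₁ => ((fun κ u => coProjBmAtK (toSite r) N (Y κ u)) - Y) κ₁ u₁ κ' u') κ u)
            - ((fun κ u => coProjBmAtK (toSite r) N (Y κ u)) - Y))) κ u κ' u' x z a (Sum.inl β₀)|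
      ≤ (2 * ((d : ℝ) + 1) * N) ^ 3 * ∑ v ∈ cube (d + 1) N, ∑ v₁ ∈ cube (d + 1) N, ∑ v₂ ∈ cube (d + 1) N,
          |∑ β' : Fin (d + 1),
            ((∑ β : Fin (d + 1), ((∑ γ : Fin (d + 1), (Y β (u + v₁) β' (u' + v₂) x (z + v) a (Sum.inl γ) - Y β (u + v₁) β' (u' + v₂) x (z + v - unitVec γ) a (Sum.inl γ)))
                - (∑ γ : Fin (d + 1), (Y β (u + v₁ - unitVec β) β' (u' + v₂) x (z + v) a (Sum.inl γ)
                    - Y β (u + v₁ - unitVec β) β' (u' + v₂) x (z + v - unitVec γ) a (Sum.inl γ)))))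
            - (∑ β : Fin (d + 1), ((∑ γ : Fin (d + 1), (Y β (u + v₁) β' (u' + v₂ - unitVec β') x (z + v) a (Sum.inl γ)
                    - Y β (u + v₁) β' (u' + v₂ - unitVec β') x (z + v - unitVec γ) a (Sum.inl γ)))
                - (∑ γ : Fin (d + 1), (Y β (u + v₁ - unitVec β) β' (u' + v₂ - unitVec β') x (z + v) a (Sum.inl γ)
                    - Y β (u + v₁ - unitVec β) β' (u' + v₂ - unitVec β') x (z + v - unitVec γ) a (Sum.inl γ))))))| := by
  set U : Tab d := (fun κ u κ' u' => coProjBmAtK (toSite r) N (fun κ₁ u₁ => ((fun κ u => coProjBmAtK (toSite r) N (Y κ u)) - Y) κ₁ u₁ κ' u') κ u)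
      - ((fun κ u => coProjBmAtK (toSite r) N (Y κ u)) - Y) with hU
  have h1 := abs_legDefect₂_inl_le hN hr U κ u κ' u' x z a β₀
  have h3 : ∀ v ∈ cube (d + 1) N, |∑ γ : Fin (d + 1), (U κ u κ' u' x (z + v) a (Sum.inl γ) - U κ u κ' u' x (z + v - unitVec γ) a (Sum.inl γ))|
      ≤ (2 * ((d : ℝ) + 1) * N) ^ 2 * ∑ v₁ ∈ cube (d + 1) N, ∑ v₂ ∈ cube (d + 1) N,
          |∑ β' : Fin (d + 1),
            ((∑ β : Fin (d + 1), ((∑ γ : Fin (d + 1), (Y β (u + v₁) β' (u' + v₂) x (z + v) a (Sum.inl γ) - Y β (u + v₁) β' (u' + v₂) x (z + v - unitVec γ) a (Sum.inl γ)))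
                - (∑ γ : Fin (d + 1), (Y β (u + v₁ - unitVec β) β' (u' + v₂) x (z + v) a (Sum.inl γ)
                    - Y β (u + v₁ - unitVec β) β' (u' + v₂) x (z + v - unitVec γ) a (Sum.inl γ)))))
            - (∑ β : Fin (d + 1), ((∑ γ : Fin (d + 1), (Y β (u + v₁) β' (u' + v₂ - unitVec β') x (z + v) a (Sum.inl γ)
                    - Y β (u + v₁) β' (u' + v₂ - unitVec β') x (z + v - unitVec γ) a (Sum.inl γ)))
                - (∑ γ : Fin (d + 1), (Y β (u + v₁ - unitVec β) β' (u' + v₂ - unitVec β') x (z + v) a (Sum.inl γ)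
                    - Y β (u + v₁ - unitVec β) β' (u' + v₂ - unitVec β') x (z + v - unitVec γ) a (Sum.inl γ))))))| := by
    intro v _
    have e : ∑ γ : Fin (d + 1), (U κ u κ' u' x (z + v) a (Sum.inl γ) - U κ u κ' u' x (z + v - unitVec γ) a (Sum.inl γ))
        = coProjBmAt (toSite r) N (fun κ₁ u₁ => coProjBmAt (toSite r) N (fun κ₂ u₂ =>
              ∑ γ : Fin (d + 1), (Y κ₁ u₁ κ₂ u₂ x (z + v) a (Sum.inl γ) - Y κ₁ u₁ κ₂ u₂ x (z + v - unitVec γ) a (Sum.inl γ))) κ' u'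
            - ∑ γ : Fin (d + 1), (Y κ₁ u₁ κ' u' x (z + v) a (Sum.inl γ) - Y κ₁ u₁ κ' u' x (z + v - unitVec γ) a (Sum.inl γ))) κ u
          - (coProjBmAt (toSite r) N (fun κ₂ u₂ =>
              ∑ γ : Fin (d + 1), (Y κ u κ₂ u₂ x (z + v) a (Sum.inl γ) - Y κ u κ₂ u₂ x (z + v - unitVec γ) a (Sum.inl γ))) κ' u'
            - ∑ γ : Fin (d + 1), (Y κ u κ' u' x (z + v) a (Sum.inl γ) - Y κ u κ' u' x (z + v - unitVec γ) a (Sum.inl γ))) := by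
      rw [defect₂_finset_sum_sub]
      refine Finset.sum_congr rfl fun γ _ => ?_
      rw [hU, defect_fst_snd_apply, defect_fst_snd_apply]
    rw [e]
    exact abs_realDefect₂_le hN hr (fun κ₁ u₁ κ₂ u₂ =>
      ∑ γ : Fin (d + 1), (Y κ₁ u₁ κ₂ u₂ x (z + v) a (Sum.inl γ) - Y κ₁ u₁ κ₂ u₂ x (z + v - unitVec γ) a (Sum.inl γ))) κ u κ' u'
  refine h1.trans ((mul_le_mul_of_nonneg_left (Finset.sum_le_sum h3) (two_mul_nonneg d N)).trans (le_of_eq ?_))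
  rw [← Finset.mul_sum]
  ring

/-- [folklore] `D_{2,1,L₂}` vanishes on multiplier columns. -/
theorem defect_fst_snd_leg₂_inr (ρ : Fin (d + 1) → ℤ) (N : ℕ) (Y : Tab d) (κ : Fin (d + 1)) (u : Fin (d + 1) → ℤ) (κ' : Fin (d + 1))
    (u' x z : Fin (d + 1) → ℤ) (a : Fib d) (m : Fin (d + 1)) :
    ((fun κ u κ' u' => legCo₂BmAt ρ N
          (((fun κ u κ' u' => coProjBmAtK ρ N (fun κ₁ u₁ => ((fun κ u => coProjBmAtK ρ N (Y κ u)) - Y) κ₁ u₁ κ' u') κ u)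
            - ((fun κ u => coProjBmAtK ρ N (Y κ u)) - Y)) κ u κ' u'))
        - ((fun κ u κ' u' => coProjBmAtK ρ N (fun κ₁ u₁ => ((fun κ u => coProjBmAtK ρ N (Y κ u)) - Y) κ₁ u₁ κ' u') κ u)
            - ((fun κ u => coProjBmAtK ρ N (Y κ u)) - Y))) κ u κ' u' x z a (Sum.inr m) = 0 :=
  legDefect₂_inr ρ N _ κ u κ' u' x z a m

end Nests

end Summit.QuantumFields.BalabanUV.Beta.GAN24.SlotDefectWindowNests

end
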